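import Mathlib
import Summits.Ventures.HodgeRepro.FaceCensusEngine
import Summits.Ventures.HodgeRepro.CMType
import Summits.Ventures.HodgeRepro.HodgeSets
import Summits.Ventures.HodgeRepro.CMRank
import Summits.Ventures.HodgeRepro.Primitive

/-!
# Bridge: the sealer's Cayley-table engine ↔ the finite-group model (blind cell `pub-hodge-repro`, seat p2)

The sealer's `FaceCensusEngine.lean` works with a Cayley table `Γ : CMGaloisType n` on `Fin n`, CM types as
bitmasks `T < 2^n` and `Bool` predicates.  This file reads that data in the typer's model: a `Group`
structure on the element type `Elt Γ` (a synonym of `Fin n`) built from the table once the `Bool` check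
`Γ.isCMGaloisType` holds, complex conjugation `conj Γ = Γ.conj` as an `IsComplexConj`, masks as
`Finset (Elt Γ)` (`finsetOf`), and the engine's operations as the model's: `bar` = `conj Γ • ·`,
`twist j` = `rmul · g_j`, `flipAt π` = symmetric difference with the place `{g, c g}`, `isCMType` =
`IsCMType`.  Definitions only bridge; nothing here asserts anything about the Hodge conjecture.
-/

set_option autoImplicit false

open Finset
open scoped Pointwise

namespace HodgeRepro

namespace EngineBridge

open Summit.Ventures.HodgeRepro.FaceCensus

variable {n : ℕ}

/-! ### The `Bool` axioms as propositions -/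

/-- The engine's bit test `mem i T` unfolds to `Nat.testBit`. -/
theorem mem_eq (i : Fin n) (T : ℕ) : mem i T = T.testBit i.val := rfl

/-- The engine's `Bool` check `isCMGaloisType` as a proposition: associativity, two-sided identity, right
inverses, `conj` central, `conj * conj = 1`, `conj ≠ 1`. -/
theorem isCMGaloisType_iff (Γ : CMGaloisType n) :
    Γ.isCMGaloisType = true ↔
      (∀ i j k, Γ.mul (Γ.mul i j) k = Γ.mul i (Γ.mul j k)) ∧
      (∀ i, Γ.mul Γ.one i = i ∧ Γ.mul i Γ.one = i) ∧
      (∀ i, ∃ j, Γ.mul i j = Γ.one) ∧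
      (∀ i, Γ.mul Γ.conj i = Γ.mul i Γ.conj) ∧
      Γ.mul Γ.conj Γ.conj = Γ.one ∧ Γ.conj ≠ Γ.one := by
  simp only [CMGaloisType.isCMGaloisType, Bool.and_eq_true, List.all_eq_true, List.any_eq_true,
    List.mem_finRange, true_and, beq_iff_eq, Bool.not_eq_eq_eq_not, Bool.not_true, beq_eq_false_iff_ne,
    ne_eq, true_implies, and_assoc]

/-! ### The element type and its group structure -/

/-- The element type of the table `Γ`: a synonym of `Fin n` carrying the table's multiplication. -/
def Elt (_Γ : CMGaloisType n) : Type := Fin n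

namespace Elt

variable (Γ : CMGaloisType n)

/-- `Elt Γ` is finite (it is `Fin n`). -/
instance : Fintype (Elt Γ) := inferInstanceAs (Fintype (Fin n))
/-- Decidable equality on `Elt Γ` (that of `Fin n`). -/
instance : DecidableEq (Elt Γ) := inferInstanceAs (DecidableEq (Fin n))
/-- Multiplication on `Elt Γ`: the Cayley table. -/
instance : Mul (Elt Γ) := ⟨fun a b => Γ.mul a b⟩
/-- The identity of `Elt Γ`: the table's `one`. -/
instance : One (Elt Γ) := ⟨Γ.one⟩

/-- The index of an element (the identity map to `Fin n`). -/
def idx (a : Elt Γ) : Fin n := a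

/-- The element with a given index. -/
def ofIdx (i : Fin n) : Elt Γ := i

/-- `idx` is a left inverse of `ofIdx`. -/
@[simp] theorem idx_ofIdx (i : Fin n) : idx Γ (ofIdx Γ i) = i := rfl
/-- `ofIdx` is a left inverse of `idx`. -/
@[simp] theorem ofIdx_idx (a : Elt Γ) : ofIdx Γ (idx Γ a) = a := rfl

/-- Multiplication on `Elt Γ` unfolds to the table. -/
theorem mul_def (a b : Elt Γ) : a * b = ofIdx Γ (Γ.mul (idx Γ a) (idx Γ b)) := rfl
/-- The identity of `Elt Γ` unfolds to the table's `one`. -/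
theorem one_def : (1 : Elt Γ) = ofIdx Γ Γ.one := rfl

/-- Complex conjugation of the table. -/
def conj : Elt Γ := ofIdx Γ Γ.conj

/-- `conj Γ` unfolds to the table's `conj` index. -/
theorem conj_def : conj Γ = ofIdx Γ Γ.conj := rfl

section Good

variable [hΓ : Fact (Γ.isCMGaloisType = true)]

/-- The group axioms of the table, read off `Fact (Γ.isCMGaloisType = true)`. -/
theorem axioms : (∀ i j k, Γ.mul (Γ.mul i j) k = Γ.mul i (Γ.mul j k)) ∧
      (∀ i, Γ.mul Γ.one i = i ∧ Γ.mul i Γ.one = i) ∧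
      (∀ i, ∃ j, Γ.mul i j = Γ.one) ∧
      (∀ i, Γ.mul Γ.conj i = Γ.mul i Γ.conj) ∧
      Γ.mul Γ.conj Γ.conj = Γ.one ∧ Γ.conj ≠ Γ.one :=
  (isCMGaloisType_iff Γ).1 hΓ.out

/-- A classically chosen right inverse for every element of the table. -/
noncomputable instance : Inv (Elt Γ) :=
  ⟨fun a => ofIdx Γ (Classical.choose ((axioms Γ).2.2.1 (idx Γ a)))⟩

/-- The chosen right inverse is a right inverse. -/
theorem mul_inv_cancel' (a : Elt Γ) : a * a⁻¹ = 1 :=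
  Classical.choose_spec ((axioms Γ).2.2.1 (idx Γ a))

/-- The group structure of the table (right axioms: associativity, right identity, right inverses). -/
noncomputable instance : Group (Elt Γ) :=
  Group.ofRightAxioms (fun a b c => (axioms Γ).1 a b c) (fun a => ((axioms Γ).2.1 a).2)
    (mul_inv_cancel' Γ)

/-- The table's `conj` is a complex conjugation of the group `Elt Γ`: non-trivial, an involution, central. -/
theorem isComplexConj_conj : IsComplexConj (conj Γ) where
  ne_one := (axioms Γ).2.2.2.2.2
  mul_self := (axioms Γ).2.2.2.2.1
  comm := fun g => (axioms Γ).2.2.2.1 g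

end Good

end Elt

/-! ### Masks as finsets -/

/-- The finset of a bitmask. -/
def finsetOf (Γ : CMGaloisType n) (T : ℕ) : Finset (Elt Γ) :=
  univ.filter fun i => mem (Elt.idx Γ i) T = true

/-- Membership in `finsetOf Γ T` is the engine's bit test. -/
theorem mem_finsetOf (Γ : CMGaloisType n) {i : Elt Γ} {T : ℕ} :
    i ∈ finsetOf Γ T ↔ mem (Elt.idx Γ i) T = true := by
  simp [finsetOf]

/-- Membership in `finsetOf Γ T` as `Nat.testBit`. -/
theorem mem_finsetOf' (Γ : CMGaloisType n) {i : Elt Γ} {T : ℕ} :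
    i ∈ finsetOf Γ T ↔ T.testBit (Elt.idx Γ i).val = true :=
  mem_finsetOf Γ

/-- Membership in a flip is the exclusive or. -/
theorem mem_flipAt_engine (i : Fin n) (π T : ℕ) : mem i (flipAt π T) = (mem i T ^^ mem i π) := by
  simp [mem_eq, flipAt, Nat.testBit_xor]

/-- The engine's `flipAt π` is the symmetric difference of the finsets. -/
theorem finsetOf_flipAt (Γ : CMGaloisType n) (π T : ℕ) :
    finsetOf Γ (flipAt π T) = symmDiff (finsetOf Γ T) (finsetOf Γ π) := by
  ext i
  rw [mem_symmDiff, mem_finsetOf, mem_finsetOf, mem_finsetOf, mem_flipAt_engine]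
  cases mem (Elt.idx Γ i) T <;> cases mem (Elt.idx Γ i) π <;> simp

/-- Membership in a singleton mask. -/
theorem mem_bit (i j : Fin n) : mem i (bit j) = true ↔ i = j := by
  simp only [mem_eq, bit, Nat.testBit_two_pow, decide_eq_true_eq]
  exact ⟨fun h => (Fin.ext h).symm, fun h => congrArg Fin.val h.symm⟩

/-- Membership in an image mask. -/
theorem mem_imageMask (f : Fin n → Fin n) (T : ℕ) (k : Fin n) :
    mem k (imageMask f T) = true ↔ ∃ i, mem i T = true ∧ f i = k := by
  unfold imageMask
  -- generalise the accumulator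
  suffices H : ∀ (l : List (Fin n)) (acc : ℕ),
      mem k (l.foldl (fun acc i => if mem i T then acc ||| bit (f i) else acc) acc) = true ↔
        (mem k acc = true ∨ ∃ i ∈ l, mem i T = true ∧ f i = k) by
    rw [H]
    simp [mem_eq, List.mem_finRange]
  intro l
  induction l with
  | nil => intro acc; simp
  | cons a l ih =>
    intro acc
    simp only [List.foldl_cons, List.mem_cons]
    rw [ih]
    by_cases ha : mem a T = true
    · simp only [ha, if_true]
      have : mem k (acc ||| bit (f a)) = true ↔ (mem k acc = true ∨ k = f a) := by
        simp only [mem_eq, Nat.testBit_or, Bool.or_eq_true]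
        rw [← mem_eq, ← mem_eq, mem_bit]
      rw [this]
      constructor
      · rintro ((h | h) | ⟨i, hi, hiT, hik⟩)
        · exact Or.inl h
        · exact Or.inr ⟨a, Or.inl rfl, ha, h.symm⟩
        · exact Or.inr ⟨i, Or.inr hi, hiT, hik⟩
      · rintro (h | ⟨i, (rfl | hi), hiT, hik⟩)
        · exact Or.inl (Or.inl h)
        · exact Or.inl (Or.inr hik.symm)
        · exact Or.inr ⟨i, hi, hiT, hik⟩
    · simp only [ha]
      constructor
      · rintro (h | ⟨i, hi, hiT, hik⟩)
        · exact Or.inl h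
        · exact Or.inr ⟨i, Or.inr hi, hiT, hik⟩
      · rintro (h | ⟨i, (rfl | hi), hiT, hik⟩)
        · exact Or.inl h
        · exact absurd hiT ha
        · exact Or.inr ⟨i, hi, hiT, hik⟩

section Good

variable (Γ : CMGaloisType n) [Fact (Γ.isCMGaloisType = true)]

omit [Fact (Γ.isCMGaloisType = true)] in
/-- `bar T = c T`. -/
theorem finsetOf_bar (T : ℕ) : finsetOf Γ (Γ.bar T) = Elt.conj Γ • finsetOf Γ T := by
  ext k
  rw [mem_finsetOf, CMGaloisType.bar, mem_imageMask, mem_smul_finset]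
  constructor
  · rintro ⟨i, hi, rfl⟩
    exact ⟨Elt.ofIdx Γ i, (mem_finsetOf Γ).2 hi, rfl⟩
  · rintro ⟨y, hy, rfl⟩
    exact ⟨Elt.idx Γ y, (mem_finsetOf Γ).1 hy, rfl⟩

/-- `twist j T = T · g_j` (right translation). -/
theorem finsetOf_twist (j : Fin n) (T : ℕ) :
    finsetOf Γ (Γ.twist j T) = rmul (finsetOf Γ T) (Elt.ofIdx Γ j) := by
  ext k
  rw [mem_finsetOf, CMGaloisType.twist, mem_imageMask, mem_rmul]
  constructor
  · rintro ⟨i, hi, rfl⟩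
    have : Elt.ofIdx Γ (Γ.mul i j) = Elt.ofIdx Γ i * Elt.ofIdx Γ j := rfl
    show Elt.ofIdx Γ (Γ.mul i j) * (Elt.ofIdx Γ j)⁻¹ ∈ finsetOf Γ T
    rw [this, mul_inv_cancel_right]
    exact (mem_finsetOf Γ).2 hi
  · intro hk
    refine ⟨Elt.idx Γ (k * (Elt.ofIdx Γ j)⁻¹), (mem_finsetOf Γ).1 hk, ?_⟩
    show Elt.idx Γ (k * (Elt.ofIdx Γ j)⁻¹ * Elt.ofIdx Γ j) = Elt.idx Γ k
    rw [inv_mul_cancel_right]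

omit [Fact (Γ.isCMGaloisType = true)] in
/-- The place `{g, c g}` of `g`. -/
theorem finsetOf_placeMask (i : Fin n) :
    finsetOf Γ (Γ.placeMask i) = {Elt.ofIdx Γ i, Elt.conj Γ * Elt.ofIdx Γ i} := by
  ext k
  simp only [mem_finsetOf, CMGaloisType.placeMask, mem_eq, Nat.testBit_or, Bool.or_eq_true,
    mem_insert, mem_singleton]
  rw [← mem_eq, ← mem_eq, mem_bit, mem_bit]
  rfl

/-- `isCMType T` is the model's `IsCMType` (plus the bound `T < 2^n`). -/
theorem isCMType_iff (T : ℕ) :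
    Γ.isCMType T = true ↔ T < 2 ^ n ∧ IsCMType (Elt.conj Γ) (finsetOf Γ T) := by
  simp only [CMGaloisType.isCMType, Bool.and_eq_true, decide_eq_true_eq, List.all_eq_true,
    List.mem_finRange, true_implies, bne_iff_ne, ne_eq]
  refine and_congr Iff.rfl ?_
  unfold IsCMType
  constructor
  · intro h g
    have := h (Elt.idx Γ g)
    rw [mem_finsetOf, mem_finsetOf]
    show mem (Elt.idx Γ g) T = true ↔ ¬ mem (Γ.mul Γ.conj (Elt.idx Γ g)) T = true
    cases hg : mem (Elt.idx Γ g) T <;> cases hcg : mem (Γ.mul Γ.conj (Elt.idx Γ g)) T <;>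
      simp_all
  · intro h i
    have := h (Elt.ofIdx Γ i)
    rw [mem_finsetOf, mem_finsetOf] at this
    change mem i T = true ↔ ¬ mem (Γ.mul Γ.conj i) T = true at this
    cases hg : mem i T <;> cases hcg : mem (Γ.mul Γ.conj i) T <;> simp_all

end Good

end EngineBridge

end HodgeRepro
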